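import Summits.FinalStateConjecture.FinalStateConjecture.Theorems.EIHFluxBalanceInertialRecessionLorentz
import Literature.Geometry.Lorentzian.KerrDataSchwarzschildExtrinsic
import Literature.Geometry.Lorentzian.BoostedKerrSchildDecay

/-!
# Route EIHFluxBalance — `InertialRecession`, line `sublinear-is-free-clean-window-charges`:
# the covariant closed form of the painted Schwarzschild summand (slaving stub `stub_slaving`,
# foundation of the symbolic coercivity certificates)

Helper file for the crux `stmt-FinalStateConjecture-10166`
(`Summit.FinalStateConjecture.FinalStateConjecture.Theses.EIHFluxBalance.InertialRecession`),
stub `stub_slaving`. The coercivity COER of the slaving analysis is a statement about the explicit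
polynomial dependence of `Ric` of ONE painted summand on the painted jets (see the analysis in
`…StubSlaving11JetAbsorb`); its Lean certificate needs the summand as an EXPLICIT algebraic function
of the invariant moduli. For spin `0` the painted Kerr–Schild summand depends on the Lorentz label
`Λ` only through the painted `4`-velocity `u = Λ e₀` (spherical symmetry), and this file proves the
covariant closed form

  `boostedKerrBilin Λ c M 0 x (v, w) = η(v, w) + (2M / r) L(v) L(w)`,
  `r = √(η(z, z) + η(u, z)²)`,  `L(v) = −η(u, v) + (η(z, v) + η(u, z) η(u, v)) / r`,  `z = x − c`

(`boostedKerrBilin_zero_spin_covariant`), together with the rest-frame bookkeeping it rests on: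
`η(Λ⁻¹z, Λ⁻¹v) = η(z, v)` (`lorentzGroup.minkowski_symm_apply`), `(Λ⁻¹z)⁰ = −η(Λe₀, z)` (`lorentz_symm_apply_zero_eq`),
`‖(Λ⁻¹z)~‖² = η(z, z) + η(Λe₀, z)²` (`spatialNorm_lorentz_symm_sq`), hence
`r₀(Λ⁻¹(x − c)) = √(η(z,z) + η(u,z)²)` for the Schwarzschild painted radius
(`radius_zero_poincareInv_eq_sqrt`), and `ℓ(y)(Λ⁻¹v) = L(v)` for the Kerr–Schild covector at
`a = 0` (`nullCovector_zero_lorentz_symm`). Kerr–Schild 1965, §2 (Lorentz covariance of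
`η + 2H ℓ ⊗ ℓ`); O'Neill 1983, Ch. 9, p. 233. No definitions, no named facts.
-/

set_option linter.dupNamespace false

noncomputable section

open Literature.Geometry.Lorentzian
open scoped InnerProductSpace

namespace Summit.FinalStateConjecture.FinalStateConjecture.Theorems.SublinearIsFree.Slaving

/-! ### Rest-frame bookkeeping for `Λ⁻¹` -/

/-- `η(e₀, Λ⁻¹v) = η(Λe₀, v)`. [folklore] -/
theorem minkowski_basisVector_lorentz_symm (Λ : lorentzGroup) (v : E4) :
    Minkowski.bilin (E4.basisVector 0) ((Λ : E4 ≃L[ℝ] E4).symm v) =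
      Minkowski.bilin ((Λ : E4 ≃L[ℝ] E4) (E4.basisVector 0)) v := by
  have h := Λ.2 (E4.basisVector 0) ((Λ : E4 ≃L[ℝ] E4).symm v)
  rw [ContinuousLinearEquiv.apply_symm_apply] at h
  exact h.symm

/-- **Rest-frame time**: `(Λ⁻¹v)⁰ = −η(Λe₀, v)`. [folklore] -/
theorem lorentz_symm_apply_zero_eq (Λ : lorentzGroup) (v : E4) :
    ((Λ : E4 ≃L[ℝ] E4).symm v) 0 = -Minkowski.bilin ((Λ : E4 ≃L[ℝ] E4) (E4.basisVector 0)) v := by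
  rw [← minkowski_basisVector_lorentz_symm, minkowski_bilin_basisVector_zero_left, neg_neg]

/-- **Rest-frame spatial norm**: `‖(Λ⁻¹z)~‖² = η(z, z) + η(Λe₀, z)²`. [folklore] -/
theorem spatialNorm_lorentz_symm_sq (Λ : lorentzGroup) (z : E4) :
    E4.spatialNorm ((Λ : E4 ≃L[ℝ] E4).symm z) ^ 2 =
      Minkowski.bilin z z + (Minkowski.bilin ((Λ : E4 ≃L[ℝ] E4) (E4.basisVector 0)) z) ^ 2 := by
  have h1 := minkowski_bilin_self ((Λ : E4 ≃L[ℝ] E4).symm z)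
  rw [lorentzGroup.minkowski_symm_apply, lorentz_symm_apply_zero_eq] at h1
  linarith [h1, neg_sq (Minkowski.bilin ((Λ : E4 ≃L[ℝ] E4) (E4.basisVector 0)) z)]

/-- **The Schwarzschild painted radius in covariant form**:
`r₀(Λ⁻¹(x − c)) = √(η(z, z) + η(u, z)²)`, `z = x − c`, `u = Λe₀`. [folklore] -/
theorem radius_zero_poincareInv_eq_sqrt (Λ : lorentzGroup) (c x : E4) :
    Kerr.radius 0 (poincareInv Λ c x) = √(Minkowski.bilin (x - c) (x - c) +
      (Minkowski.bilin ((Λ : E4 ≃L[ℝ] E4) (E4.basisVector 0)) (x - c)) ^ 2) := by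
  rw [Kerr.radius_zero_left, poincareInv, ← spatialNorm_lorentz_symm_sq,
    Real.sqrt_sq (E4.spatialNorm_nonneg _)]

/-- `⟪y~, w~⟫ = η(y, w) + y⁰ w⁰` (time/space split of `η`). [folklore] -/
theorem inner_spatial_eq_minkowski_add (y w : E4) :
    ⟪E4.spatial y, E4.spatial w⟫_ℝ = Minkowski.bilin y w + y 0 * w 0 := by
  have hin : ⟪E4.spatial y, E4.spatial w⟫_ℝ = y 1 * w 1 + y 2 * w 2 + y 3 * w 3 := by
    simp [PiLp.inner_apply, Fin.sum_univ_three, E4.spatial_apply, mul_comm]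
  rw [hin, Minkowski.bilin_apply, Fin.sum_univ_three]
  simp only [Fin.succ_zero_eq_one, Fin.succ_one_eq_two]
  rw [show (2 : Fin 3).succ = (3 : Fin 4) from rfl]
  ring

/-- **The Kerr–Schild covector at `a = 0` in covariant form**: with `y = Λ⁻¹z` off the axis,
`ℓ(y)(Λ⁻¹v) = −η(u, v) + (η(z, v) + η(u, z) η(u, v)) / ‖y~‖`, `u = Λe₀`. [folklore] -/
theorem nullCovector_zero_lorentz_symm (Λ : lorentzGroup) (z v : E4)
    (hy : E4.spatial ((Λ : E4 ≃L[ℝ] E4).symm z) ≠ 0) :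
    Kerr.nullCovector 0 ((Λ : E4 ≃L[ℝ] E4).symm z) ((Λ : E4 ≃L[ℝ] E4).symm v) =
      -Minkowski.bilin ((Λ : E4 ≃L[ℝ] E4) (E4.basisVector 0)) v +
        (Minkowski.bilin z v + Minkowski.bilin ((Λ : E4 ≃L[ℝ] E4) (E4.basisVector 0)) z *
          Minkowski.bilin ((Λ : E4 ≃L[ℝ] E4) (E4.basisVector 0)) v) /
          E4.spatialNorm ((Λ : E4 ≃L[ℝ] E4).symm z) := by
  rw [Kerr.nullCovector_zero_eq _ hy, Kerr.nullCovectorZero_apply, inner_spatial_eq_minkowski_add,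
    lorentzGroup.minkowski_symm_apply, lorentz_symm_apply_zero_eq, lorentz_symm_apply_zero_eq, E4.spatialNorm,
    div_eq_inv_mul]
  ring

/-! ### The covariant closed form -/

/-- **Covariant closed form of the painted Schwarzschild summand.** For every `Λ ∈ O(1,3)`,
centre `c`, mass `M` and point `x` whose rest-frame position `Λ⁻¹(x − c)` is off the axis:
`boostedKerrBilin Λ c M 0 x (v, w) = η(v, w) + (2M/r) L(v) L(w)` with `z = x − c`, `u = Λe₀`,
`r = √(η(z,z) + η(u,z)²)` and `L(v) = −η(u,v) + (η(z,v) + η(u,z) η(u,v))/r`. In particular the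
summand depends on `Λ` only through `u` (spherical symmetry: the stabiliser of `e₀` acts
trivially), which is why slaving is stated for `Λe₀` and not for `Λ`. Kerr–Schild 1965, §2.
[folklore] -/
theorem boostedKerrBilin_zero_spin_covariant (Λ : lorentzGroup) (c : E4) (M : ℝ) (x v w : E4)
    (hx : E4.spatial (poincareInv Λ c x) ≠ 0) :
    boostedKerrBilin Λ c M 0 x v w = Minkowski.bilin v w +
      2 * M / √(Minkowski.bilin (x - c) (x - c) +
          (Minkowski.bilin ((Λ : E4 ≃L[ℝ] E4) (E4.basisVector 0)) (x - c)) ^ 2) *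
        ((-Minkowski.bilin ((Λ : E4 ≃L[ℝ] E4) (E4.basisVector 0)) v +
          (Minkowski.bilin (x - c) v + Minkowski.bilin ((Λ : E4 ≃L[ℝ] E4) (E4.basisVector 0)) (x - c) *
            Minkowski.bilin ((Λ : E4 ≃L[ℝ] E4) (E4.basisVector 0)) v) /
            √(Minkowski.bilin (x - c) (x - c) +
              (Minkowski.bilin ((Λ : E4 ≃L[ℝ] E4) (E4.basisVector 0)) (x - c)) ^ 2)) *
         (-Minkowski.bilin ((Λ : E4 ≃L[ℝ] E4) (E4.basisVector 0)) w +
          (Minkowski.bilin (x - c) w + Minkowski.bilin ((Λ : E4 ≃L[ℝ] E4) (E4.basisVector 0)) (x - c) *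
            Minkowski.bilin ((Λ : E4 ≃L[ℝ] E4) (E4.basisVector 0)) w) /
            √(Minkowski.bilin (x - c) (x - c) +
              (Minkowski.bilin ((Λ : E4 ≃L[ℝ] E4) (E4.basisVector 0)) (x - c)) ^ 2))) := by
  have hr : √(Minkowski.bilin (x - c) (x - c) +
      (Minkowski.bilin ((Λ : E4 ≃L[ℝ] E4) (E4.basisVector 0)) (x - c)) ^ 2) =
      E4.spatialNorm ((Λ : E4 ≃L[ℝ] E4).symm (x - c)) := by
    rw [← spatialNorm_lorentz_symm_sq, Real.sqrt_sq (E4.spatialNorm_nonneg _)]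
  have hx' : E4.spatial ((Λ : E4 ≃L[ℝ] E4).symm (x - c)) ≠ 0 := hx
  rw [hr, boostedKerrBilin_apply, poincareInv, Kerr.bilin_zero_eq_bilinZero M hx',
    Kerr.bilinZero_apply, lorentzGroup.minkowski_symm_apply, ← Kerr.nullCovector_zero_eq _ hx',
    nullCovector_zero_lorentz_symm Λ _ _ hx', nullCovector_zero_lorentz_symm Λ _ _ hx', E4.spatialNorm]

/-- **Registered one-line carrier form** (`slaving_boostedKerrBilin_zero_spin_covariant_slaving11`)
of `boostedKerrBilin_zero_spin_covariant`. [folklore] -/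
theorem slaving_boostedKerrBilin_zero_spin_covariant_slaving11 : open Literature.Geometry.Lorentzian in ∀ (Λ : lorentzGroup) (c : E4) (M : ℝ) (x v w : E4), E4.spatial (poincareInv Λ c x) ≠ 0 → boostedKerrBilin Λ c M 0 x v w = Minkowski.bilin v w + 2 * M / √(Minkowski.bilin (x - c) (x - c) + (Minkowski.bilin ((Λ : E4 ≃L[ℝ] E4) (E4.basisVector 0)) (x - c)) ^ 2) * ((-Minkowski.bilin ((Λ : E4 ≃L[ℝ] E4) (E4.basisVector 0)) v + (Minkowski.bilin (x - c) v + Minkowski.bilin ((Λ : E4 ≃L[ℝ] E4) (E4.basisVector 0)) (x - c) * Minkowski.bilin ((Λ : E4 ≃L[ℝ] E4) (E4.basisVector 0)) v) / √(Minkowski.bilin (x - c) (x - c) + (Minkowski.bilin ((Λ : E4 ≃L[ℝ] E4) (E4.basisVector 0)) (x - c)) ^ 2)) * (-Minkowski.bilin ((Λ : E4 ≃L[ℝ] E4) (E4.basisVector 0)) w + (Minkowski.bilin (x - c) w + Minkowski.bilin ((Λ : E4 ≃L[ℝ] E4) (E4.basisVector 0)) (x - c) * Minkowski.bilin ((Λ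 : E4 ≃L[ℝ] E4) (E4.basisVector 0)) w) / √(Minkowski.bilin (x - c) (x - c) + (Minkowski.bilin ((Λ : E4 ≃L[ℝ] E4) (E4.basisVector 0)) (x - c)) ^ 2))) :=
  fun Λ c M x v w hx ↦ boostedKerrBilin_zero_spin_covariant Λ c M x v w hx

end Summit.FinalStateConjecture.FinalStateConjecture.Theorems.SublinearIsFree.Slaving

end
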